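import Literature.NumberTheory.PAdicHodge.CyclotomicTilt
import Mathlib.Analysis.Normed.Field.Dense
import HarnessLib

/-!
# `ℂ_F` is algebraically closed, and the untilt `♯ : 𝒪_{ℂ_F}♭ → 𝒪_{ℂ_F}` is surjective

Topic `Literature/NumberTheory/PAdicHodge`; namespace `Literature.NumberTheory.PAdicHodge`. Sequel of `CompletedAlgClosure` (`ℂ_F = \\widehat{F̄}`,
`F̄` dense) and `BdRKummerUnitPeriod` §1 (`p`-power root systems of elements of `F̄` and their tilts `rootTilt`, `untilt_rootTilt`).

* ★ `CompletedAlgClosure.isAlgClosed` — **`ℂ_F` is algebraically closed** (Krasner: an algebraically closed DENSE subfield of a complete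
  non-archimedean field of characteristic `0` — Mathlib `IsAlgClosed.of_denseRange`, applied to `F̄ ⊆ ℂ_F` with the nontrivially-normed structure
  `NontriviallyNormedField.ofNormNeOne` read off `F`). A theorem, not an instance (install with `haveI`).
* `CompletedAlgClosure.exists_pow_nat_eq` — `n`-th roots in `ℂ_F`; `rootSeqC`, `rootIntC`, `rootTiltC` — a `p`-power root system of ANY
  `u ∈ 𝒪_{ℂ_F}` and its tilt (the `F̄`-free twin of `rootSeq` / `rootC` / `rootTilt`), ★ `untilt_rootTiltC : (rootTiltC u)♯ = u`, hence
  ★★ `PreTilt.untilt_surjective` — **`♯ : 𝒪_{ℂ_F}♭ → 𝒪_{ℂ_F}` is surjective** (Fontaine: `R = lim_{x ↦ x^p} 𝒪_C → 𝒪_C`, `x ↦ x^{(0)}` is onto because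
  `C` is algebraically closed).

Use (line `kato_lever` of crux K★ `stmt-BirchSwinnertonDyer-22226`, the LEAD's (H4) step (2) `θ(X₂) = ℂ_F` for `X₂ = ℚ_p · log[1+𝔪♭]`): every
principal unit of `ℂ_F` is `ũ♯`, so `θ(log[1+𝔪♭]) = log(1+𝔪_ℂ)`, and with `CompletedAlgClosurePadicNorm` (`log` surjective near `0`) and
ℚ_p-scaling, `θ(X₂) = ℂ_F`. Infrastructure; BSD / K★ / [REC] are NOT proved by any of this.

## References
* J.-M. Fontaine, *Le corps des périodes p-adiques*, Astérisque 223 (1994), Exp. II §1.2.2–1.2.3. [FontaineAsterisque223III]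
* J.-M. Fontaine, Y. Ouyang, *Theory of p-adic Galois representations*, §3.1 (`C` is algebraically closed), §4.3. [FontaineOuyang2022]
* J. Neukirch, *Algebraic Number Theory* (1999), Ch. II (6.x) Krasner's lemma / (10.x). [NeukirchANT1999]
-/

noncomputable section

open ValuativeRel Field Ideal UniformSpace

namespace Literature.NumberTheory.PAdicHodge

open Literature.NumberTheory.GaloisRepresentations
open Literature.NumberTheory.GaloisRepresentations.IsNonarchimedeanLocalField

variable {F : Type} [Field F] [ValuativeRel F] [TopologicalSpace F] [IsNonarchimedeanLocalField F] [CharZero F]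

/-! ## §1 `ℂ_F` is algebraically closed -/

namespace CompletedAlgClosure

/-- ★ **`ℂ_F` is algebraically closed**: `F̄` is algebraically closed and dense in the complete non-archimedean field `ℂ_F` of characteristic
`0` (Mathlib `IsAlgClosed.of_denseRange`, Krasner's lemma). [cite: FontaineOuyang2022, §3.1] [cite: NeukirchANT1999, Ch. II (6.x)] -/
theorem isAlgClosed : IsAlgClosed (CompletedAlgClosure F) := by
  -- a nontrivially-normed structure on `ℂ_F` with the SAME normed field underneath: `F` has an element of norm `> 1`
  letI := nontriviallyNormedField F
  obtain ⟨x, hx⟩ := NontriviallyNormedField.non_trivial (α := F)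
  have hx1 : ‖algebraMap F (CompletedAlgClosure F) x‖ ≠ 1 := by rw [norm_algebraMap]; exact hx.ne'
  have hx0 : algebraMap F (CompletedAlgClosure F) x ≠ 0 := fun h => by
    rw [h, norm_zero] at hx1
    have : (1 : ℝ) < 0 := by rw [← norm_algebraMap (F := F) x, h, norm_zero] at hx; exact hx
    exact absurd this (by norm_num)
  letI : NontriviallyNormedField (CompletedAlgClosure F) := NontriviallyNormedField.ofNormNeOne ⟨_, hx0, hx1⟩
  haveI : CharZero (CompletedAlgClosure F) := charZero_of_injective_algebraMap (algebraMap F (CompletedAlgClosure F)).injective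
  exact IsAlgClosed.of_denseRange (K := NormedAlgClosure F) denseRange_coe

/-- Roots in `ℂ_F`: every `u` has an `n`-th root (`0 < n`). [cite: FontaineOuyang2022, §3.1] -/
theorem exists_pow_nat_eq (u : CompletedAlgClosure F) {n : ℕ} (hn : 0 < n) : ∃ r : CompletedAlgClosure F, r ^ n = u :=
  haveI := isAlgClosed (F := F)
  IsAlgClosed.exists_pow_nat_eq u hn

end CompletedAlgClosure

/-! ## §2 `p`-power root systems of elements of `𝒪_{ℂ_F}` and the surjectivity of `♯` -/

variable {p : ℕ} [hprime : Fact p.Prime]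

variable (p) in
/-- **A `p`-power root system of `u ∈ ℂ_F`**: `u_0 = u`, `u_{n+1}` a chosen `p`-th root of `u_n` (`ℂ_F` algebraically closed).
[cite: FontaineAsterisque223III, Exp. II §1.2.2] -/
def rootSeqC (u : CompletedAlgClosure F) : ℕ → CompletedAlgClosure F
  | 0 => u
  | n + 1 => Classical.choose (CompletedAlgClosure.exists_pow_nat_eq (rootSeqC u n) hprime.out.pos)

/-- `rootSeqC u 0 = u`. [cite: FontaineAsterisque223III, Exp. II §1.2.2] -/
@[simp] theorem rootSeqC_zero (u : CompletedAlgClosure F) : rootSeqC p u 0 = u := rfl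

/-- `(u_{n+1})^p = u_n`. [cite: FontaineAsterisque223III, Exp. II §1.2.2] -/
theorem rootSeqC_succ_pow (u : CompletedAlgClosure F) (n : ℕ) : rootSeqC p u (n + 1) ^ p = rootSeqC p u n :=
  Classical.choose_spec (CompletedAlgClosure.exists_pow_nat_eq (rootSeqC p u n) hprime.out.pos)

/-- `u_n ^ pⁿ = u`. [cite: FontaineAsterisque223III, Exp. II §1.2.2] -/
theorem rootSeqC_pow (u : CompletedAlgClosure F) (n : ℕ) : rootSeqC p u n ^ p ^ n = u := by
  induction n with
  | zero => simp
  | succ n ih => rw [pow_succ', pow_mul, rootSeqC_succ_pow, ih]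

/-- `‖u_n‖ ≤ 1` when `‖u‖ ≤ 1`. [cite: FontaineAsterisque223III, Exp. II §1.2.2] -/
theorem norm_rootSeqC_le (u : CompletedAlgClosure F) (hu : ‖u‖ ≤ 1) (n : ℕ) : ‖rootSeqC p u n‖ ≤ 1 := by
  have h : ‖rootSeqC p u n‖ ^ p ^ n ≤ 1 := by rw [← norm_pow, rootSeqC_pow]; exact hu
  exact (pow_le_one_iff_of_nonneg (norm_nonneg _) (pow_ne_zero n hprime.out.ne_zero)).1 h

variable (p) in
/-- The root system of `u ∈ 𝒪_{ℂ_F}` read in `𝒪_{ℂ_F}`. [cite: FontaineAsterisque223III, Exp. II §1.2.2] -/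
def rootIntC (u : integerC F) (n : ℕ) : integerC F :=
  ⟨rootSeqC p (u : CompletedAlgClosure F) n, by
    rw [mem_integerC_iff]; exact norm_rootSeqC_le _ ((mem_integerC_iff (F := F)).1 u.2) n⟩

/-- `rootIntC u 0 = u`. [cite: FontaineAsterisque223III, Exp. II §1.2.2] -/
@[simp] theorem rootIntC_zero (u : integerC F) : rootIntC p u 0 = u := Subtype.ext rfl

/-- `rootIntC u (n+1)^p = rootIntC u n`. [cite: FontaineAsterisque223III, Exp. II §1.2.2] -/
theorem rootIntC_succ_pow (u : integerC F) (n : ℕ) : rootIntC p u (n + 1) ^ p = rootIntC p u n :=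
  Subtype.ext (by rw [SubmonoidClass.coe_pow]; exact rootSeqC_succ_pow _ n)

/-- `rootIntC u n ^ pⁿ = u`. [cite: FontaineAsterisque223III, Exp. II §1.2.2] -/
theorem rootIntC_pow (u : integerC F) (n : ℕ) : rootIntC p u n ^ p ^ n = u :=
  Subtype.ext (by rw [SubmonoidClass.coe_pow]; exact rootSeqC_pow _ n)

variable [Fact (¬ IsUnit (p : integerC F))]

variable (p) in
/-- **The tilt `ũ = (u_n mod p)_n ∈ 𝒪_{ℂ_F}♭` of the root system of `u ∈ 𝒪_{ℂ_F}`.** [cite: FontaineAsterisque223III, Exp. II §1.2.2] -/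
def rootTiltC (u : integerC F) : PreTilt (integerC F) p :=
  ⟨fun n => Ideal.Quotient.mk _ (rootIntC p u n), fun n => by rw [← map_pow, rootIntC_succ_pow]⟩

/-- Coefficients of `ũ`. [cite: FontaineAsterisque223III, Exp. II §1.2.2] -/
@[simp] theorem coeff_rootTiltC (u : integerC F) (n : ℕ) :
    PreTilt.coeff n (rootTiltC p u) = Ideal.Quotient.mk _ (rootIntC p u n) := rfl

variable [IsAdicComplete (Ideal.span {(p : integerC F)}) (integerC F)]

/-- ★ **`ũ♯ = u`** for every `u ∈ 𝒪_{ℂ_F}` (`♯ = lim u_n^{pⁿ}`, Mathlib `Perfection.teichmuller_spec`). [cite: FontaineAsterisque223III, Exp. II §1.2.2] -/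
theorem untilt_rootTiltC (u : integerC F) : PreTilt.untilt (rootTiltC p u) = u := by
  change Perfection.teichmuller p (Ideal.span {(p : integerC F)}) (rootTiltC p u) = _
  refine Perfection.teichmuller_spec fun n => ⟨rootIntC p u n, rfl, ?_⟩
  rw [rootIntC_pow]
  exact SModEq.refl (M := integerC F) _

/-- ★★ **The untilt `♯ : 𝒪_{ℂ_F}♭ → 𝒪_{ℂ_F}` is surjective** (`ℂ_F` is algebraically closed, so every `u ∈ 𝒪_{ℂ_F}` has a `p`-power root
system). [cite: FontaineAsterisque223III, Exp. II §1.2.2–1.2.3] [cite: FontaineOuyang2022, §4.3] -/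
theorem PreTilt.untilt_surjective : Function.Surjective (PreTilt.untilt : PreTilt (integerC F) p → integerC F) :=
  fun u => ⟨rootTiltC p u, untilt_rootTiltC u⟩

/-- Every `c ∈ ℂ_F` with `‖c‖ ≤ 1` is `x♯` for some `x ∈ 𝒪_{ℂ_F}♭`. [cite: FontaineAsterisque223III, Exp. II §1.2.2–1.2.3] -/
theorem CompletedAlgClosure.exists_untilt_coe_eq {c : CompletedAlgClosure F} (hc : ‖c‖ ≤ 1) :
    ∃ x : PreTilt (integerC F) p, ((PreTilt.untilt x : integerC F) : CompletedAlgClosure F) = c := by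
  obtain ⟨x, hx⟩ := PreTilt.untilt_surjective (F := F) (p := p) ⟨c, (mem_integerC_iff (F := F)).2 hc⟩
  exact ⟨x, by rw [hx]⟩

end Literature.NumberTheory.PAdicHodge

end
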